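import Summits.Schanuel.Schanuel.Theorems.DiophantineDichotomyApproximationPropertyDefs
import Literature.NumberTheory.Transcendental.NesterenkoEliminationProp411Holds
import Literature.NumberTheory.Transcendental.NesterenkoEliminationProp47Holds
import Literature.NumberTheory.Transcendental.PhilipponCriterionCut
import Literature.NumberTheory.Transcendental.ProjectiveNoIsolatedPoints
import HarnessLib

/-!
# Stub `orbit_ratio_degree` of line `orbit-interpolation-determinant` (crux `ApproximationProperty`, stmt-Schanuel-6117)

Crux `stmt-Schanuel-6117` (`Summit.Schanuel.Schanuel.Theses.DiophantineDichotomy.ApproximationProperty`),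
route `DiophantineDichotomy`, line `orbit-interpolation-determinant`, registered stub
`orbit_ratio_degree` (lead c4 wave 2, part A; it feeds the skeleton stub
`orbitFloorLog := orbitFloorLog_of_ratioDegree orbit_ratio_degree`).

**Metric Bézout in the chart `x₀ ≠ 0`.** Let `𝔮 ⊆ 𝔭` be homogeneous primes of
`ℚ[x₀, …, x₃]`, `𝔮` of rank `2` (a `ℚ`-curve of degree `δₛ = deg 𝔮`) and `𝔭` of rank `1` (a Galois
orbit of `D = deg 𝔭` points), and let `V(𝔭)` be the set of multiples of the conjugates `σb` of one
point `b ∈ K⁴` over a number field `K`, `b₀ ≠ 0` (the data of `ZeroDimDictionary`, here taken as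
hypotheses). Then some coordinate ratio `y_j = b_{j+1}/b₀` has
`D ≤ δₛ · deg (minpoly_ℚ y_j)`.

Proof. Let `m_j` be the minimal polynomial of `y_j` (`n_j = deg m_j ≥ 1`) and `F_j ∈ ℚ[x₀, x_{j+1}]`
its homogenisation `x₀^{n_j} m_j(x_{j+1}/x₀)` (`OrbitRatioDegree.exists_homogenization`), a form of
degree `n_j` vanishing at every `l·σb`, hence `F_j ∈ 𝔭` (projective Nullstellensatz
`PhilipponMain.mem_of_forall_mem_projZeros_aeval_eq_zero`).
* If some `F_j ∉ 𝔮`: Nesterenko's Prop. 4.11 (`NesterenkoPhilippon2001_ch3_prop_4_11_holds`, PROVED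
  in the tree) cuts `𝔮` by `F_j` into a homogeneous unmixed `J` of rank `1` with
  `V(J) = V((𝔮, F_j)) ⊇ V(𝔭)` and `deg J ≤ deg 𝔮 · n_j`; as `V(𝔭) ≠ ∅` lies in the union of the
  zero sets of the (rank-`1`, homogeneous, prime) radicals of a reduced primary decomposition of
  `J`, one of them is contained in `𝔭` (`exists_le_of_projZeros_subset_biUnion`), hence equal to
  `𝔭` (`eq_of_le_of_isUnmixedOfRank`), and Prop. 4.7 1) (`NesterenkoPhilippon2001_ch3_prop_4_7_holds`,
  PROVED) gives `deg 𝔭 ≤ deg J` (`ideg_radical_le`).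
* If all three `F_j ∈ 𝔮`: every zero `(1 : z)` of `𝔮` has `m_j(z_j) = 0` for each `j`, so the
  affine zeros of `𝔮` in the chart `x₀ = 1` form a finite set — contradicting
  `infinite_projZeros_near` (a prime of rank `≥ 2` has infinitely many zeros `(1 : z)` near its
  zero `(1 : σ₀ y)`).

Proofs only (no definitions, no named facts). The hypothesis `[K:ℚ] = deg 𝔭` of the registered
signature is not used.

Sources: NesterenkoPhilippon2001 (LNM 1752) Ch. 3 §4, Prop. 4.7 (p. 39), Prop. 4.11 (pp. 40–41);
Philippon1986Criteres §3 p. 41 (the homogenisation `ʰP`); Mumford, *Algebraic Geometry I*,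
Thm (2.33) (no isolated points); folklore algebra.
-/

noncomputable section

-- `Summit.Schanuel.Schanuel.…` is the mandated summit/sub-problem namespace (single-conjunct summit), hence:
set_option linter.dupNamespace false

attribute [local instance] MvPolynomial.gradedAlgebra

namespace Summit.Schanuel.Schanuel.Cruxes.ApproximationProperty.OrbitInterpolationDeterminant

open Literature.NumberTheory.Transcendental Literature.NumberTheory.Transcendental.Nesterenko
open Literature.NumberTheory.Transcendental.PhilipponMain MvPolynomial
open scoped BigOperators Polynomial

namespace OrbitRatioDegree

/-! ## Homogenisation of a univariate rational polynomial in one of the variables `x_k` -/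

/-- **Homogenisation** of a univariate polynomial `p ∈ ℚ[X]` in the variable `x_k` against `x₀`:
`F = Σ_{i ≤ deg p} p_i x₀^{deg p − i} x_k^i ∈ ℚ[x₀, …, x_m]` is a form of degree `deg p` with
`F(ω̄) = p(ω_k)` whenever `ω₀ = 1`. [cite: Philippon1986Criteres, §3 p. 41 (ʰP)] -/
theorem exists_homogenization {m : ℕ} (p : ℚ[X]) (k : Fin (m + 1)) :
    ∃ F : Rx m, F.IsHomogeneous p.natDegree ∧
      ∀ ω : Fin (m + 1) → ℂ, ω 0 = 1 → aeval ω F = Polynomial.aeval (ω k) p := by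
  classical
  refine ⟨∑ i ∈ Finset.range (p.natDegree + 1),
    C (p.coeff i) * X 0 ^ (p.natDegree - i) * X k ^ i, ?_, ?_⟩
  · refine IsHomogeneous.sum _ _ _ fun i hi => ?_
    have hi' : i ≤ p.natDegree := Nat.lt_succ_iff.mp (Finset.mem_range.mp hi)
    have h := ((isHomogeneous_C (Fin (m + 1)) (p.coeff i)).mul
      (isHomogeneous_X_pow (R := ℚ) (0 : Fin (m + 1)) (p.natDegree - i))).mul
      (isHomogeneous_X_pow (R := ℚ) k i)
    rwa [zero_add, Nat.sub_add_cancel hi'] at h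
  · intro ω hω
    rw [Polynomial.aeval_eq_sum_range, map_sum]
    refine Finset.sum_congr rfl fun i _ => ?_
    rw [map_mul, map_mul, map_pow, map_pow, aeval_C, aeval_X, aeval_X, hω, one_pow, mul_one,
      Algebra.smul_def]

/-- Zeros of a homogenisation off the hyperplane `x₀ = 0`: for `F` homogeneous with
`F(ω̄) = p(ω_k)` when `ω₀ = 1`, and `y₀ ≠ 0`, `F(y) = 0 ↔ p(y_k / y₀) = 0`. [folklore] -/
theorem aeval_eq_zero_iff {m : ℕ} {p : ℚ[X]} {k : Fin (m + 1)} {F : Rx m} {d : ℕ}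
    (hF : F.IsHomogeneous d)
    (hval : ∀ ω : Fin (m + 1) → ℂ, ω 0 = 1 → aeval ω F = Polynomial.aeval (ω k) p)
    {y : Fin (m + 1) → ℂ} (hy : y 0 ≠ 0) :
    aeval y F = 0 ↔ Polynomial.aeval (y k / y 0) p = 0 := by
  have hscale : y = y 0 • ((y 0)⁻¹ • y) := by
    rw [smul_smul, mul_inv_cancel₀ hy, one_smul]
  have h1 : aeval y F = y 0 ^ d * aeval ((y 0)⁻¹ • y) F := by
    conv_lhs => rw [hscale]
    exact aeval_smul_of_isHomogeneous hF _ _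
  have h2 : aeval ((y 0)⁻¹ • y) F = Polynomial.aeval (y k / y 0) p := by
    rw [hval _ (by simp [hy]), Pi.smul_apply, smul_eq_mul, div_eq_inv_mul]
  rw [h1, h2, mul_eq_zero, or_iff_right (pow_ne_zero _ hy)]

end OrbitRatioDegree

/-- **Stub `orbit_ratio_degree` (metric Bézout in the chart `x₀ ≠ 0`; registered name
`orbit_ratio_degree`).** For homogeneous primes `𝔮 ⊆ 𝔭` of `ℚ[x₀, …, x₃]` of ranks `2` and `1`,
and a number field `K` with a point `b ∈ K⁴`, `b₀ ≠ 0`, whose conjugates (up to scaling) are exactly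
the zeros of `𝔭`, some ratio `b_{j+1}/b₀` has `deg 𝔭 ≤ deg 𝔮 · deg minpoly_ℚ(b_{j+1}/b₀)`: cut the
curve `𝔮` by the homogenised minimal polynomial `F_j ∈ 𝔭 ∖ 𝔮` (Prop. 4.11), find `𝔭` among the
associated primes of the cut (Prop. 4.7 1)), or — if all `F_j ∈ 𝔮` — contradict the infinitude of
the zeros of a curve near a point.
[cite: NesterenkoPhilippon2001, Ch. 3 Prop. 4.7 1) (p. 39), Prop. 4.11 1) (pp. 40–41)] -/
theorem orbit_ratio_degree : ∀ (𝔭 𝔮 : Ideal (Rx 3)), 𝔭.IsPrime → 𝔭.IsHomogeneous (homogeneousSubmodule (Fin (3 + 1)) ℚ) → IsUnmixedOfRank 𝔭 1 → 𝔮.IsPrime → 𝔮.IsHomogeneous (homogeneousSubmodule (Fin (3 + 1)) ℚ) → IsUnmixedOfRank 𝔮 2 → 𝔮 ≤ 𝔭 → ∀ (K : Type) [Field K] [NumberField K] (b : Fin (3 + 1) → K), b 0 ≠ 0 → (∀ β : Fin (3 + 1) → ℂ, β ∈ projZeros 𝔭 ↔ β ≠ 0 ∧ ∃ (σ : K →+*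 ℂ) (l : ℂ), β = fun j => l * σ (b j)) → Module.finrank ℚ K = ideg 𝔭 1 → ∃ j : Fin 3, ideg 𝔭 1 ≤ ideg 𝔮 2 * (minpoly ℚ (b j.succ / b 0)).natDegree := by
  intro 𝔭 𝔮 h𝔭 _ h𝔭unm h𝔮 h𝔮hom h𝔮unm h𝔮𝔭 K _ _ b hb0 hdict _
  classical
  -- the ratios `y_j = b_{j+1}/b₀`, their minimal polynomials and homogenisations `F_j`
  set y : Fin 3 → K := fun j => b j.succ / b 0 with hy
  have hint : ∀ j, IsIntegral ℚ (y j) := fun j => IsIntegral.of_finite ℚ (y j)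
  have hn : ∀ j, 1 ≤ (minpoly ℚ (y j)).natDegree := fun j => minpoly.natDegree_pos (hint j)
  have hp0 : ∀ j, minpoly ℚ (y j) ≠ 0 := fun j => minpoly.ne_zero (hint j)
  choose F hF hFval using fun j : Fin 3 =>
    OrbitRatioDegree.exists_homogenization (m := 3) (minpoly ℚ (y j)) j.succ
  have hσb0 : ∀ σ : K →+* ℂ, σ (b 0) ≠ 0 := fun σ => (map_ne_zero σ).mpr hb0
  -- `F_j` vanishes at every `l · σb`
  have hFzero : ∀ (j : Fin 3) (σ : K →+* ℂ) (l : ℂ),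
      aeval (fun i => l * σ (b i)) (F j) = 0 := by
    intro j σ l
    by_cases hl : l = 0
    · have h0 : (fun i => l * σ (b i)) = 0 := by
        funext i
        rw [hl, zero_mul, Pi.zero_apply]
      rw [h0]
      exact aeval_zero_eq_zero_of_isHomogeneous (hF j) (hn j)
    · have hy0 : (fun i => l * σ (b i)) 0 ≠ 0 := mul_ne_zero hl (hσb0 σ)
      rw [OrbitRatioDegree.aeval_eq_zero_iff (hF j) (hFval j) hy0]
      have he : l * σ (b j.succ) / (l * σ (b 0)) = σ.toRatAlgHom (y j) := by
        rw [mul_div_mul_left _ _ hl, RingHom.toRatAlgHom_apply, hy, map_div₀]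
      rw [he, Polynomial.aeval_algHom_apply, minpoly.aeval, map_zero]
  -- hence `F_j ∈ 𝔭`
  have hF𝔭 : ∀ j, F j ∈ 𝔭 := by
    intro j
    refine mem_of_forall_mem_projZeros_aeval_eq_zero h𝔭
      (aeval_zero_eq_zero_of_isHomogeneous (hF j) (hn j)) fun β hβ => ?_
    obtain ⟨-, σ, l, rfl⟩ := (hdict β).mp hβ
    exact hFzero j σ l
  -- an embedding `σ₀` and the zero `(1 : σ₀ y)` of `𝔭`
  let σ₀ : K →+* ℂ := (IsAlgClosed.lift : K →ₐ[ℚ] ℂ).toRingHom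
  set c : Fin 3 → ℂ := fun i => σ₀ (y i) with hc
  have hcons : (Fin.cons 1 c : Fin (3 + 1) → ℂ) = fun i => (σ₀ (b 0))⁻¹ * σ₀ (b i) := by
    funext i
    refine Fin.cases ?_ (fun i => ?_) i
    · rw [Fin.cons_zero, inv_mul_cancel₀ (hσb0 σ₀)]
    · rw [Fin.cons_succ, hc, hy]
      simp only
      rw [map_div₀, div_eq_inv_mul]
  have hc𝔭 : (Fin.cons 1 c : Fin (3 + 1) → ℂ) ∈ projZeros 𝔭 :=
    (hdict _).mpr ⟨cons_one_ne_zero c, σ₀, (σ₀ (b 0))⁻¹, hcons⟩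
  have h𝔮c : ∀ g ∈ 𝔮, ∀ k : ℕ, homogeneousComponent k g ∈ 𝔮 :=
    fun g hg k => homogeneousComponent_mem_of_mem h𝔮hom hg k
  by_cases hall : ∀ j, F j ∈ 𝔮
  · -- all `F_j ∈ 𝔮`: the zeros `(1 : z)` of `𝔮` form a finite set, contradiction
    exfalso
    have hc𝔮 : (Fin.cons 1 c : Fin (3 + 1) → ℂ) ∈ projZeros 𝔮 := projZeros_antitone h𝔮𝔭 hc𝔭
    have hinf := infinite_projZeros_near (le_refl 2) h𝔮 h𝔮c h𝔮unm hc𝔮 one_pos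
    refine hinf (Set.Finite.subset
      (Set.Finite.pi fun i : Fin 3 => (minpoly ℚ (y i)).rootSet_finite ℂ) ?_)
    rintro z ⟨hz, -⟩
    rw [Set.mem_univ_pi]
    intro i
    rw [Polynomial.mem_rootSet_of_ne (hp0 i)]
    have h := hz.2 (F i) (hall i)
    rwa [hFval i _ (cons_one_zero z), Fin.cons_succ] at h
  · -- some `F_j ∉ 𝔮`: cut the curve by `F_j`
    push Not at hall
    obtain ⟨j, hj⟩ := hall
    refine ⟨j, ?_⟩
    have h411 := NesterenkoPhilippon2001_ch3_prop_4_11_holds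
    have h47 := NesterenkoPhilippon2001_ch3_prop_4_7_holds
    obtain ⟨J, hJhom, hJunm, hJV, hJdeg, -, -⟩ :=
      (h411 3 2 𝔮 (F j) _ (by norm_num) (by norm_num) h𝔮 h𝔮hom h𝔮unm (hF j) (hn j) hj).1 le_rfl
    have hJunm1 : IsUnmixedOfRank J 1 := hJunm
    have hJdeg1 : ideg J 1 ≤ ideg 𝔮 2 * (minpoly ℚ (y j)).natDegree := hJdeg
    -- `V(𝔭) ⊆ V(J) = ⋃ V(√Q)` over a reduced primary decomposition `t` of `J`
    have hV : projZeros 𝔭 ⊆ projZeros J := by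
      rw [hJV]
      refine projZeros_antitone (sup_le h𝔮𝔭 ?_)
      rw [Ideal.span_le, Set.singleton_subset_iff]
      exact hF𝔭 j
    obtain ⟨t, ht⟩ : ∃ t : Finset (Ideal (Rx 3)), Submodule.IsMinimalPrimaryDecomposition J t :=
      Submodule.IsLasker.exists_isMinimalPrimaryDecomposition (Submodule.isLasker _ _) J
    have hQfacts := fun (Q : Ideal (Rx 3)) (hQ : Q ∈ t) =>
      Literature.Barriers.Schanuel.radical_component_facts hJhom hJunm1 ht hQ
    have hVU : projZeros 𝔭 ⊆ ⋃ Q ∈ t, projZeros Q.radical := by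
      rw [← projZeros_eq_biUnion_radical ht.inf_eq]
      exact hV
    -- one of the `√Q` is contained in `𝔭`, hence equals `𝔭`
    obtain ⟨Q, hQt, hle⟩ := exists_le_of_projZeros_subset_biUnion (s := t)
      (𝔭 := fun Q : Ideal (Rx 3) => Q.radical) h𝔭
      (fun Q hQ => fun g hg k => homogeneousComponent_mem_of_mem (hQfacts Q hQ).2.1 hg k)
      (fun Q hQ => (hQfacts Q hQ).1.ne_top) ⟨_, hc𝔭⟩ hVU
    have heq : Q.radical = 𝔭 :=
      eq_of_le_of_isUnmixedOfRank (hQfacts Q hQt).1 h𝔭 hle (hQfacts Q hQt).2.2.1 h𝔭unm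
    -- Prop. 4.7 1): `deg 𝔭 ≤ deg J`
    obtain ⟨hsum1, -, -⟩ :=
      h47 3 1 J le_rfl (by norm_num) hJhom hJunm1 t ht _ (cons_one_ne_zero c)
    have hk1 : ∀ Q' ∈ t, 1 ≤ primaryExponent Q' := fun Q' hQ' => (hQfacts Q' hQ').2.2.2.2
    have hdeg𝔭 : ideg 𝔭 1 ≤ ideg J 1 := by
      rw [← heq]
      exact ideg_radical_le hsum1 hk1 hQt
    exact hdeg𝔭.trans hJdeg1

end Summit.Schanuel.Schanuel.Cruxes.ApproximationProperty.OrbitInterpolationDeterminant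

end
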